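import Summits.QuantumAdvantage.QuantumAdvantage.Theorems.WbwObfuscatedGluedTrees.Negative.TypedTraps
import Literature.Computability.Complexity.CodeFPArith

/-!
# `WbwObfuscatedGluedTrees` (stmt-QuantumAdvantage-2340) — VII: the coin-length advice channel of `IsPPT`

Negative / support lemma for the INFORMAL crux `WbwObfuscatedGluedTrees` of route
`Summits/QuantumAdvantage/QuantumAdvantage/Theses/WhiteBoxWalk`, filed by the deep-refute seat on
line `knowledge-of-walk-split` (`Cruxes/WbwObfuscatedGluedTrees/Lines/knowledge-of-walk-split.lean`,
stubs `stub_obfuscationMonotone`, `stub_bestPossibleStep`).  Sorry-free; no Theses decl is asserted;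
the clause refuted in `clauseC_false_of_ans_lengthIndexed` is LITERALLY clause (C) of `WbwThesis`
for a fixed pair `(gen, ans)` (the body of the line's `ClauseC gen ans`, `Iff.rfl`).

THE MODEL FEATURE.  In the tree, `IsPPT A eb = RandAlg.IsPolyTime id eb` asks the map
`(x, r) ↦ A.run x r` to be polynomial-time on `boolPair x r` and the coin budget `A.coinLen` to be
polynomially BOUNDED — not computable (`Randomized.lean`, design note; Gill's "polynomial time on
every input and every coin sequence").  Consequently every polynomially bounded function
`c : ℕ → ℕ` of the INPUT LENGTH, computable or not, is OUTPUT with probability `1` by the PPT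
`⟨fun _ r => bin |r|, c⟩` ("coin counter"; `coinCounter_isPPT`, `pr_coinCounter`): the adversary class
of clause (C) carries `O(log L)` bits of length-indexed advice.  Two uses:

* `clauseC_false_of_ans_lengthIndexed` — a typed trap in the style of `TypedTraps.lean`: an answer
  that is (a prefix of) the numeral of a poly-bounded function of `|⟨1ⁿ, gen s⟩|` is never hard,
  however uncomputable that function is;
* the reason the transfer stubs of the line need POLYNOMIALLY BOUNDED INSTANCE LENGTHS (evidence
  notes `Negative-notes/stub_obfuscationMonotone.md`, `…/stub_bestPossibleStep.md` of the crux
  folder): a reduction that re-runs a given PPT `A` on a self-made instance `w` must feed `A`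
  exactly `A.coinLen |w|` coins, a value it cannot compute and can only GUESS at a loss polynomial
  in `|w|` — superpolynomial in the seed length `n` when instances are superpolynomially long; and
  in that regime the channel separates the two worlds of `stub_obfuscationMonotone` (the obfuscated
  code's LENGTH may depend on the structure of the clear circuit, so `A.coinLen |w|` reads a
  key-dependent table entry that no PPT facing the clear instance, whose length depends on `n`
  alone, can reproduce — a diagonal table; see the note).
-/

set_option linter.dupNamespace false

namespace Summit.QuantumAdvantage.QuantumAdvantage.Theorems.WbwObfuscatedGluedTrees.Negative

open Literature.Computability.Cryptography Literature.Computability.Complexity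
open Filter Asymptotics _root_.Computability

namespace CoinLengthAdvice

/-! The **coin counter** with coin budget `c` is the randomized algorithm
`⟨fun _ r => encodeNat r.length, c⟩ : RandAlg (List Bool) (List Bool)` — ignore the input, output the number of
coins received as a binary numeral.  (Written out in every statement: this support file declares no definition.) -/

/-- The coin counter is PPT for EVERY polynomially bounded budget `c` — computable or not: its run map
`⟨x, r⟩ ↦ bin |r|` is polynomial-time (`CodeFP.strNatLength ∘ snd`) and `IsPolyTime` asks nothing
more of `coinLen` than a polynomial bound. [folklore] -/
theorem coinCounter_isPPT (c : ℕ → ℕ) (hc : ∃ p : Polynomial ℕ, ∀ n, c n ≤ p.eval n) :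
    IsPPT (⟨fun _ r => encodeNat r.length, c⟩ : RandAlg (List Bool) (List Bool)) id := by
  refine ⟨?_, hc⟩
  have h : CodeFP (CodeFP.pairE CodeFP.strE CodeFP.strE) CodeFP.strE
      (fun p : List Bool × List Bool => encodeNat p.2.length) :=
    (CodeFP.strNatLength.comp (CodeFP.snd CodeFP.strE CodeFP.strE)).recodeOut fun _ => rfl
  exact h.polyTimeComputable

/-- The output law of the coin counter on `x` is the point mass at `bin (c |x|)`. [folklore] -/
theorem outputPMF_coinCounter (c : ℕ → ℕ) (x : List Bool) :
    (⟨fun _ r => encodeNat r.length, c⟩ : RandAlg (List Bool) (List Bool)).outputPMF id x =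
      PMF.pure (encodeNat (c x.length)) := by
  unfold RandAlg.outputPMF
  have hfun : (fun r : List.Vector Bool (c (id x).length) => encodeNat r.toList.length) =
      fun _ => encodeNat (c x.length) := by
    funext r
    show encodeNat r.toList.length = encodeNat (c x.length)
    rw [List.Vector.toList_length]
    rfl
  rw [hfun]
  exact PMF.map_const _ _

/-- The coin counter outputs `bin (c |x|)` with probability `1`: the probability of an event is the
indicator of `bin (c |x|) ∈ E`. [folklore] -/
theorem pr_coinCounter (c : ℕ → ℕ) (x : List Bool) (E : Set (List Bool))
    [Decidable (encodeNat (c x.length) ∈ E)] :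
    (⟨fun _ r => encodeNat r.length, c⟩ : RandAlg (List Bool) (List Bool)).pr id x E =
      if encodeNat (c x.length) ∈ E then 1 else 0 := by
  rw [RandAlg.pr, outputPMF_coinCounter, PMF.toOuterMeasure_pure_apply]
  split_ifs <;> simp [*]

/-- **Every poly-bounded function of the input length is PPT-outputtable with certainty** (the
length-indexed advice channel of `IsPPT`). [folklore] -/
theorem exists_isPPT_outputs_lengthIndexed (c : ℕ → ℕ) (hc : ∃ p : Polynomial ℕ, ∀ n, c n ≤ p.eval n) :
    ∃ A : RandAlg (List Bool) (List Bool), IsPPT A id ∧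
      ∀ x : List Bool, A.pr id x {y | y = encodeNat (c x.length)} = 1 := by
  classical
  refine ⟨_, coinCounter_isPPT c hc, fun x => ?_⟩
  rw [pr_coinCounter]
  simp

/-- **Trap (refutes a class of typings / unpadded transfer statements, not the mechanism).**  If, for
infinitely many lengths `n`, on every seed `s ∈ {0,1}ⁿ` the answer `ans s` is a prefix of the binary
numeral of `c |⟨1ⁿ, gen s⟩|` for ONE polynomially bounded `c : ℕ → ℕ` — no computability asked —,
then clause (C) of `WbwThesis` for `(gen, ans)` is FALSE: `coinCounter c` wins with probability `1` at
those lengths. [folklore] -/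
theorem clauseC_false_of_ans_lengthIndexed (gen ans : List Bool → List Bool) (c : ℕ → ℕ)
    (hc : ∃ p : Polynomial ℕ, ∀ n, c n ≤ p.eval n)
    (h : ∃ᶠ n in atTop, ∀ s : List Bool, s.length = n →
      ans s <+: encodeNat (c (boolPair (unaryEncodeNat n) (gen s)).length)) :
    ¬ ∀ A : RandAlg (List Bool) (List Bool), IsPPT A id →
      SuperpolynomialDecay atTop (fun n : ℕ => (n : ℝ)) (fun n : ℕ =>
        uniformAvg n fun s => A.pr id (boolPair (unaryEncodeNat n) (gen s)) {y | ans s <+: y}) := by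
  classical
  intro hC
  refine not_superpolynomialDecay_of_frequently_le one_pos (h.mono fun n hn => ?_)
    (hC _ (coinCounter_isPPT c hc))
  have hpr : ∀ s : List Bool, s.length = n →
      (⟨fun _ r => encodeNat r.length, c⟩ : RandAlg (List Bool) (List Bool)).pr id
        (boolPair (unaryEncodeNat n) (gen s)) {y | ans s <+: y} = 1 := by
    intro s hs
    rw [pr_coinCounter, if_pos]
    exact hn s hs
  simp only [uniformAvg]
  rw [Finset.sum_congr rfl fun (x : List.Vector Bool n) _ => hpr x.toList (by simp)]
  simp [card_vector]

end CoinLengthAdvice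

end Summit.QuantumAdvantage.QuantumAdvantage.Theorems.WbwObfuscatedGluedTrees.Negative
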